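import Summits.HodgeConjecture.HodgeConjecture.Theorems.CyclicUnitaryPowersPairPlacement
import Summits.HodgeConjecture.HodgeConjecture.Theorems.CyclicUnitaryPowersCasimirMatrix

/-!
# The pair tensors of the deck-unitary FFT are complex combinations of the rational cyclic matching tensors

Helper for stub L `stub_deckUnitaryInvariantsMatching` of the crux `PowersHodgeOfDeckCommutators`
(stmt-HodgeConjecture-19545, route `CyclicUnitaryPowers`, line `unitary-kunneth-fft` v6, lane 2).  Setting: a
finite-dimensional `ℚ`-space `V` with a form `Q` and an endomorphism `s`, complexified to `W = ℂ ⊗ V`,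
`σ = s_ℂ`, `B = Q_ℂ`, a primitive `p`-th root `ζ` (`p = 2h+1`), eigenblocks of common dimension `n`, the fixed line
`E_0 = ℂ (1 ⊗ v₀)`, and the eigen-adapted basis `f` (`CyclicUnitaryPowersEigenDualBasis`); `b` the rational basis
`Module.finBasis ℚ V` and `b' = 1 ⊗ b`.

* §1 the eigen-Casimir matrices in the rational basis: `kmat f b' i = [P_{i+1}]_{b'} G_{b'}⁻¹`
  (`CyclicUnitaryPowersCasimirMatrix`) `= Σ_k p⁻¹ ζ^{-k(i+1)} · M_k`, `M_k = [s^k]_b G_b⁻¹` RATIONAL (the coordinate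
  matrices of the cyclic matching `2`-tensors `(s^k ⊗ 1)(Casimir Q)` of the K2-A stubs);
* §2 the matching tensors `matchingTensor` (verbatim shape of the registered stub L) and
  **`pairTensor_mem_span`**: every pair tensor `pairTensor f κ e β` (`β` colour-preserving) lies in the `ℂ`-span of the
  complexified matching tensors `ι (matchingTensor …)` with free slots filled by `v₀`.

Pure linear algebra; no Hodge theory.
-/

noncomputable section

open Module Matrix
open scoped TensorProduct PiTensorProduct BigOperators

namespace Summit.HodgeConjecture.HodgeConjecture.Theorems.CyclicUnitaryPowersPairTensorRational

open Literature.AlgebraicGeometry.Motives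
open Literature.RepresentationTheory.ClassicalInvariants (contractionTensor contractionTensor_apply)
open Summit.HodgeConjecture.HodgeConjecture.Theorems.CyclicUnitaryPowersSpectralProjectors
open Summit.HodgeConjecture.HodgeConjecture.Theorems.CyclicUnitaryPowersEigenPairing
open Summit.HodgeConjecture.HodgeConjecture.Theorems.CyclicUnitaryPowersEigenDualBasis
open Summit.HodgeConjecture.HodgeConjecture.Theorems.CyclicUnitaryPowersBlockAction
open Summit.HodgeConjecture.HodgeConjecture.Theorems.CyclicUnitaryPowersPatternWords
open Summit.HodgeConjecture.HodgeConjecture.Theorems.CyclicUnitaryPowersPairPlacement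
open Summit.HodgeConjecture.HodgeConjecture.Theorems.CyclicUnitaryPowersCasimirMatrix

variable {V : Type} [AddCommGroup V] [Module ℚ V] [Module.Finite ℚ V]

/-! ### §1 The eigen-Casimir matrices in the rational basis -/

section Kmat

variable (Q : LinearMap.BilinForm ℚ V) (s : V →ₗ[ℚ] V) {p h : ℕ} {ζ : ℂ}
  (hσ : (s.baseChange ℂ) ^ p = 1) (hζ : IsPrimitiveRoot ζ p) (hp : 0 < p) (hph : p = 2 * h + 1)
  (hB : ∀ x y, Q.baseChange ℂ (s.baseChange ℂ x) (s.baseChange ℂ y) = Q.baseChange ℂ x y)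
  (hBn : (Q.baseChange ℂ).Nondegenerate) (hBs : ∀ x y, Q.baseChange ℂ x y = Q.baseChange ℂ y x)
  (hQn : Q.Nondegenerate)
  {n : ℕ} (hn : ∀ j, 1 ≤ j → j < p → Module.finrank ℂ ↥(E (s.baseChange ℂ) ζ p j) = n)
  {v₀ : V} (hx₀ : ((1 : ℂ) ⊗ₜ[ℚ] v₀ : ℂ ⊗[ℚ] V) ≠ 0) (hx₀E : ((1 : ℂ) ⊗ₜ[ℚ] v₀ : ℂ ⊗[ℚ] V) ∈ E (s.baseChange ℂ) ζ p 0)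
  (hgen : ∀ x ∈ E (s.baseChange ℂ) ζ p 0, ∃ c : ℂ, x = c • ((1 : ℂ) ⊗ₜ[ℚ] v₀))

/-- `[P_j]_{1⊗b} = p⁻¹ Σ_k (ζ^{kj})⁻¹ [s^k]_b` (entries complexified). [folklore] -/
theorem toMatrix_specProj (j : ℕ) :
    LinearMap.toMatrix (Algebra.TensorProduct.basis ℂ (Module.finBasis ℚ V)) (Algebra.TensorProduct.basis ℂ (Module.finBasis ℚ V))
        (specProj (s.baseChange ℂ) ζ p j) =
      ((p : ℂ)⁻¹) • ∑ k ∈ Finset.range p, ((ζ ^ (k * j))⁻¹) •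
        (LinearMap.toMatrix (Module.finBasis ℚ V) (Module.finBasis ℚ V) (s ^ k)).map (algebraMap ℚ ℂ) := by
  rw [specProj_def, LinearEquiv.map_smul, map_sum]
  congr 1
  refine Finset.sum_congr rfl fun k _ => ?_
  rw [LinearEquiv.map_smul, ← LinearMap.baseChange_pow, LinearMap.toMatrix_baseChange]

/-- The Gram matrix of `Q_ℂ` in `1 ⊗ b` is the complexified Gram matrix of `Q` in `b`. [folklore] -/
theorem toMatrix_baseChange_form :
    LinearMap.BilinForm.toMatrix (Algebra.TensorProduct.basis ℂ (Module.finBasis ℚ V)) (Q.baseChange ℂ) =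
      (Matrix.of fun a a' => Q (Module.finBasis ℚ V a) (Module.finBasis ℚ V a')).map (algebraMap ℚ ℂ) := by
  ext a a'
  rw [LinearMap.BilinForm.toMatrix_apply, Algebra.TensorProduct.basis_apply, Algebra.TensorProduct.basis_apply,
    LinearMap.BilinForm.baseChange_tmul, Matrix.map_apply, Matrix.of_apply, mul_one, Algebra.algebraMap_eq_smul_one]

/-- The rational Gram matrix is invertible (`Q` nondegenerate). [folklore] -/
theorem isUnit_det_gram (hQn : Q.Nondegenerate) :
    IsUnit (Matrix.of fun a a' => Q (Module.finBasis ℚ V a) (Module.finBasis ℚ V a')).det := by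
  have h : (Matrix.of fun a a' => Q (Module.finBasis ℚ V a) (Module.finBasis ℚ V a')) =
      LinearMap.BilinForm.toMatrix (Module.finBasis ℚ V) Q := by
    ext a a'; rw [Matrix.of_apply, LinearMap.BilinForm.toMatrix_apply]
  rw [h, isUnit_iff_ne_zero]
  exact Matrix.nondegenerate_iff_det_ne_zero.mp (hQn.toMatrix _)

/-- The inverse Gram matrix complexifies. [folklore] -/
theorem inv_gram_map (hQn : Q.Nondegenerate) :
    ((Matrix.of fun a a' => Q (Module.finBasis ℚ V a) (Module.finBasis ℚ V a')).map (algebraMap ℚ ℂ))⁻¹ =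
      (Matrix.of fun a a' => Q (Module.finBasis ℚ V a) (Module.finBasis ℚ V a'))⁻¹.map (algebraMap ℚ ℂ) := by
  apply Matrix.inv_eq_right_inv
  rw [← Matrix.map_mul, Matrix.mul_nonsing_inv _ (isUnit_det_gram Q hQn), Matrix.map_one _ (map_zero _) (map_one _)]

include hBs hQn in
/-- **The eigen-Casimir matrix of colour `i` in the rational basis**:
`kmat f (1⊗b) i α α' = Σ_{k<p} p⁻¹ (ζ^{k(i+1)})⁻¹ · ([s^k]_b G_b⁻¹) α α'`. [folklore] -/
theorem kmat_apply (i : Fin h) (α α' : Fin (Module.finrank ℚ V)) :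
    kmat (adaptedBasis hσ hζ hp hph hB hBn hn hx₀ hx₀E hgen) (Algebra.TensorProduct.basis ℂ (Module.finBasis ℚ V)) i α α' =
      ∑ k : Fin p, ((p : ℂ)⁻¹ * (ζ ^ ((k : ℕ) * (i.val + 1)))⁻¹) *
        algebraMap ℚ ℂ ((LinearMap.toMatrix (Module.finBasis ℚ V) (Module.finBasis ℚ V) (s ^ (k : ℕ)) *
          (Matrix.of fun a a' => Q (Module.finBasis ℚ V a) (Module.finBasis ℚ V a'))⁻¹) α α') := by
  have hk : kmat (adaptedBasis hσ hζ hp hph hB hBn hn hx₀ hx₀E hgen) (Algebra.TensorProduct.basis ℂ (Module.finBasis ℚ V)) i =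
      LinearMap.toMatrix (Algebra.TensorProduct.basis ℂ (Module.finBasis ℚ V)) (Algebra.TensorProduct.basis ℂ (Module.finBasis ℚ V))
          (specProj (s.baseChange ℂ) ζ p (i.val + 1)) *
        (LinearMap.BilinForm.toMatrix (Algebra.TensorProduct.basis ℂ (Module.finBasis ℚ V)) (Q.baseChange ℂ))⁻¹ := by
    funext β γ
    exact sum_repr_vec_mul_repr_cov hσ hζ hp hph hB hBn hn hx₀ hx₀E hgen hBs _ i β γ
  rw [hk, toMatrix_specProj, toMatrix_baseChange_form, inv_gram_map Q hQn, Matrix.smul_mul, Finset.sum_mul,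
    Matrix.smul_apply, Matrix.sum_apply, Finset.sum_range, smul_eq_mul, Finset.mul_sum]
  refine Finset.sum_congr rfl fun k _ => ?_
  rw [Matrix.smul_mul, Matrix.smul_apply, ← Matrix.map_mul, Matrix.map_apply, smul_eq_mul, mul_assoc]

end Kmat

/-! ### §2 The pair tensors in the span of the complexified matching tensors -/

section Span

variable (Q : LinearMap.BilinForm ℚ V) (s : V →ₗ[ℚ] V) (p : ℕ) (r : ℕ)

/-- **The cyclic matching tensors** of the K2-A stubs (verbatim): pairs `c` of slots filled with the `2`-tensor
of coordinate matrix `[s^{τ c}]_b G_b⁻¹`, free slots `a` filled with the vectors `z a`. [folklore] -/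
def matchingTensor (j l : ℕ) (ε : Fin r ≃ (Fin 2 × Fin j) ⊕ Fin l) (τ : Fin j → Fin p) (z : Fin l → V) :
    hodgeTensorSpace V r 0 :=
  ∑ w : Fin r → Fin (Module.finrank ℚ V),
    ((∏ c : Fin j, (LinearMap.toMatrix (Module.finBasis ℚ V) (Module.finBasis ℚ V) (s ^ ((τ c : Fin p) : ℕ)) *
        (Matrix.of fun a a' => Q ((Module.finBasis ℚ V) a) ((Module.finBasis ℚ V) a'))⁻¹)
        (w (ε.symm (Sum.inl (0, c)))) (w (ε.symm (Sum.inl (1, c))))) *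
      ∏ a : Fin l, ((Module.finBasis ℚ V).repr (z a)) (w (ε.symm (Sum.inr a)))) •
    ((PiTensorProduct.tprod ℚ fun i => (Module.finBasis ℚ V) (w i)) ⊗ₜ[ℚ]
      (PiTensorProduct.tprod ℚ fun i : Fin 0 => (Fin.elim0 i : Module.Dual ℚ V)))

variable {Q s p r}

/-- The complexified rational tensor basis vector is the tensor basis vector of `1 ⊗ b`. [folklore] -/
theorem tensorSpaceToBaseChange_basisVector (w : Fin r → Fin (Module.finrank ℚ V)) :
    tensorSpaceToBaseChange ℂ V r 0 ((PiTensorProduct.tprod ℚ fun i => (Module.finBasis ℚ V) (w i)) ⊗ₜ[ℚ]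
        (PiTensorProduct.tprod ℚ fun i : Fin 0 => (Fin.elim0 i : Module.Dual ℚ V))) =
      tmon (Algebra.TensorProduct.basis ℂ (Module.finBasis ℚ V)) w := by
  rw [tensorSpaceToBaseChange_tprod_tmul_tprod, tmon, hodgeTensorBasis_apply]
  congr 1
  · exact congrArg _ (funext fun q => (Algebra.TensorProduct.basis_apply _ _).symm)
  · exact congrArg _ (funext fun i => Fin.elim0 i)

/-- A tensor with RATIONAL coordinates in `1 ⊗ b` is the complexification of the rational tensor with these
coordinates. [folklore] -/
theorem sum_algebraMap_smul_tmon (D : (Fin r → Fin (Module.finrank ℚ V)) → ℚ) :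
    ∑ u, algebraMap ℚ ℂ (D u) • tmon (Algebra.TensorProduct.basis ℂ (Module.finBasis ℚ V)) u =
      tensorSpaceToBaseChange ℂ V r 0 (∑ u, D u •
        ((PiTensorProduct.tprod ℚ fun i => (Module.finBasis ℚ V) (u i)) ⊗ₜ[ℚ]
          (PiTensorProduct.tprod ℚ fun i : Fin 0 => (Fin.elim0 i : Module.Dual ℚ V)))) := by
  rw [map_sum]
  refine Finset.sum_congr rfl fun u _ => ?_
  rw [LinearMap.map_smul_of_tower, tensorSpaceToBaseChange_basisVector, algebraMap_smul]

end Span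

/-! ### §3 Coordinates of the pair tensors and the slot equivalence -/

section Main

variable (Q : LinearMap.BilinForm ℚ V) (s : V →ₗ[ℚ] V) {p h : ℕ} {ζ : ℂ}
  (hσ : (s.baseChange ℂ) ^ p = 1) (hζ : IsPrimitiveRoot ζ p) (hp : 0 < p) (hph : p = 2 * h + 1)
  (hB : ∀ x y, Q.baseChange ℂ (s.baseChange ℂ x) (s.baseChange ℂ y) = Q.baseChange ℂ x y)
  (hBn : (Q.baseChange ℂ).Nondegenerate) (hBs : ∀ x y, Q.baseChange ℂ x y = Q.baseChange ℂ y x)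
  (hQn : Q.Nondegenerate)
  {n : ℕ} (hn : ∀ j, 1 ≤ j → j < p → Module.finrank ℂ ↥(E (s.baseChange ℂ) ζ p j) = n)
  {v₀ : V} (hx₀ : ((1 : ℂ) ⊗ₜ[ℚ] v₀ : ℂ ⊗[ℚ] V) ≠ 0) (hx₀E : ((1 : ℂ) ⊗ₜ[ℚ] v₀ : ℂ ⊗[ℚ] V) ∈ E (s.baseChange ℂ) ζ p 0)
  (hgen : ∀ x ∈ E (s.baseChange ℂ) ζ p 0, ∃ c : ℂ, x = c • ((1 : ℂ) ⊗ₜ[ℚ] v₀))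
  {r : ℕ} (κ : Fin r → Option (Fin h × Bool)) {d : ℕ} (e : Fin d ≃ {q : Fin r // (κ q).isSome})
  (β : {k : Fin d // patTy κ e k = true} ≃ {k : Fin d // patTy κ e k = false})

/-- The rational matrices `M_k = [s^k]_b G_b⁻¹`. [folklore] -/
def ratMat (k : ℕ) : Matrix (Fin (Module.finrank ℚ V)) (Fin (Module.finrank ℚ V)) ℚ :=
  LinearMap.toMatrix (Module.finBasis ℚ V) (Module.finBasis ℚ V) (s ^ k) *
    (Matrix.of fun a a' => Q ((Module.finBasis ℚ V) a) ((Module.finBasis ℚ V) a'))⁻¹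

/-- The rational coordinate function of the placement with exponents `τ` on the pairs and `v₀` on the free slots.
[folklore] -/
def ratCoord (v₀ : V) (τ : {k : Fin d // patTy κ e k = true} → Fin p) (u : Fin r → Fin (Module.finrank ℚ V)) : ℚ :=
  (∏ q : {q : Fin r // ¬ (κ q).isSome}, (Module.finBasis ℚ V).repr v₀ (u q)) *
    ∏ a : {k : Fin d // patTy κ e k = true}, ratMat Q s (τ a : ℕ) (u (e a)) (u (e (β a)))

/-- Coordinates of `1 ⊗ v` in `1 ⊗ b` are the complexified coordinates of `v` in `b`. [folklore] -/
theorem basis_repr_one_tmul (v : V) (α : Fin (Module.finrank ℚ V)) :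
    (Algebra.TensorProduct.basis ℂ (Module.finBasis ℚ V)).repr ((1 : ℂ) ⊗ₜ[ℚ] v) α =
      algebraMap ℚ ℂ ((Module.finBasis ℚ V).repr v α) := by
  rw [Algebra.TensorProduct.basis_repr_tmul, Finsupp.smul_apply, Finsupp.mapRange_apply, one_smul]

include hBs hQn in
/-- **Coordinates of a pair tensor in the rational basis**: a combination over exponent choices `τ` of
complexified RATIONAL placement coordinates. [folklore] -/
theorem tcoord_pairTensor_eq (hβ : ∀ a, patCol κ e (β a) = patCol κ e a) (u : Fin r → Fin (Module.finrank ℚ V)) :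
    tcoord (Algebra.TensorProduct.basis ℂ (Module.finBasis ℚ V))
        (pairTensor (adaptedBasis hσ hζ hp hph hB hBn hn hx₀ hx₀E hgen) κ e β) u =
      ∑ τ : {k : Fin d // patTy κ e k = true} → Fin p,
        (∏ a, ((p : ℂ)⁻¹ * (ζ ^ (((τ a : Fin p) : ℕ) * ((patCol κ e a).val + 1)))⁻¹)) *
          algebraMap ℚ ℂ (ratCoord Q s κ e β v₀ τ u) := by
  classical
  rw [tcoord_pairTensor _ κ e β _ hβ, adaptedBasis_none]
  simp_rw [basis_repr_one_tmul, kmat_apply Q s hσ hζ hp hph hB hBn hBs hQn hn hx₀ hx₀E hgen]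
  rw [Finset.prod_univ_sum (fun _ => (Finset.univ : Finset (Fin p))), Fintype.piFinset_univ, Finset.mul_sum]
  refine Finset.sum_congr rfl fun τ _ => ?_
  rw [Finset.prod_mul_distrib, ratCoord, map_mul, map_prod, map_prod]
  simp only [ratMat]
  ring

/-- Enumeration of the vector positions. [folklore] -/
def vecEnum : Fin (Fintype.card {k : Fin d // patTy κ e k = true}) ≃ {k : Fin d // patTy κ e k = true} :=
  (Fintype.equivFin _).symm

/-- Enumeration of the free (pattern `none`) positions. [folklore] -/
def freeEnum : Fin (Fintype.card {q : Fin r // ¬ (κ q).isSome}) ≃ {q : Fin r // ¬ (κ q).isSome} :=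
  (Fintype.equivFin _).symm

/-- Position of the vector slot of pair `c`. [folklore] -/
def posVec (c : Fin (Fintype.card {k : Fin d // patTy κ e k = true})) : Fin r :=
  ((e ((vecEnum κ e c : {k : Fin d // patTy κ e k = true}) : Fin d) : {q : Fin r // (κ q).isSome}) : Fin r)

/-- Position of the covector slot of pair `c`. [folklore] -/
def posCov (c : Fin (Fintype.card {k : Fin d // patTy κ e k = true})) : Fin r :=
  ((e ((β (vecEnum κ e c) : {k : Fin d // patTy κ e k = false}) : Fin d) : {q : Fin r // (κ q).isSome}) : Fin r)

/-- Position of the free slot `a`. [folklore] -/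
def posFree (a : Fin (Fintype.card {q : Fin r // ¬ (κ q).isSome})) : Fin r :=
  ((freeEnum κ a : {q : Fin r // ¬ (κ q).isSome}) : Fin r)

/-- The forward slot map: pair `c` ↦ its two positions, free slot `a` ↦ its position. [folklore] -/
def slotMap' : (Fin 2 × Fin (Fintype.card {k : Fin d // patTy κ e k = true})) ⊕
    Fin (Fintype.card {q : Fin r // ¬ (κ q).isSome}) → Fin r :=
  Sum.elim (fun tc => (![posVec κ e, posCov κ e β] : Fin 2 → _ → Fin r) tc.1 tc.2) (posFree κ)

/-- `slotMap'` on a vector slot. [folklore] -/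
@[simp] theorem slotMap'_inl_zero (c) : slotMap' κ e β (Sum.inl (0, c)) = posVec κ e c := rfl
/-- `slotMap'` on a covector slot. [folklore] -/
@[simp] theorem slotMap'_inl_one (c) : slotMap' κ e β (Sum.inl (1, c)) = posCov κ e β c := rfl
/-- `slotMap'` on a free slot. [folklore] -/
@[simp] theorem slotMap'_inr (a) : slotMap' κ e β (Sum.inr a) = posFree κ a := rfl

/-- `posVec` is injective. [folklore] -/
theorem posVec_injective : Function.Injective (posVec κ e) := fun _ _ h =>
  (vecEnum κ e).injective (Subtype.ext (e.injective (Subtype.ext h)))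

/-- `posCov` is injective. [folklore] -/
theorem posCov_injective : Function.Injective (posCov κ e β) := fun _ _ h =>
  (vecEnum κ e).injective (β.injective (Subtype.ext (e.injective (Subtype.ext h))))

/-- `posFree` is injective. [folklore] -/
theorem posFree_injective : Function.Injective (posFree κ) := fun _ _ h => (freeEnum κ).injective (Subtype.ext h)

/-- A vector slot is not a covector slot. [folklore] -/
theorem posVec_ne_posCov (c c') : posVec κ e c ≠ posCov κ e β c' := by
  intro hcc
  have h1 : ((vecEnum κ e c : {k // patTy κ e k = true}) : Fin d) = (β (vecEnum κ e c') : {k // patTy κ e k = false}) :=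
    e.injective (Subtype.ext hcc)
  have h2 := (vecEnum κ e c).2
  rw [h1, (β (vecEnum κ e c')).2] at h2
  exact Bool.false_ne_true h2

/-- Pair slots are positions off `E_0`, free slots are positions on `E_0`. [folklore] -/
theorem isSome_posVec (c) : (κ (posVec κ e c)).isSome := (e _).2
/-- Pair slots are positions off `E_0`. [folklore] -/
theorem isSome_posCov (c) : (κ (posCov κ e β c)).isSome := (e _).2
/-- Free slots are positions on `E_0`. [folklore] -/
theorem not_isSome_posFree (a) : ¬ (κ (posFree κ a)).isSome := (freeEnum κ a).2

/-- The forward slot map is a bijection. [folklore] -/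
theorem slotMap'_bijective : Function.Bijective (slotMap' κ e β) := by
  classical
  constructor
  · rintro (⟨t, c⟩ | a) (⟨t', c'⟩ | a') hxy
    · rcases Fin.exists_fin_two.mp ⟨t, rfl⟩ with rfl | rfl <;> rcases Fin.exists_fin_two.mp ⟨t', rfl⟩ with rfl | rfl
      · rw [slotMap'_inl_zero, slotMap'_inl_zero] at hxy; rw [posVec_injective κ e hxy]
      · rw [slotMap'_inl_zero, slotMap'_inl_one] at hxy; exact absurd hxy (posVec_ne_posCov κ e β c c')
      · rw [slotMap'_inl_one, slotMap'_inl_zero] at hxy; exact absurd hxy.symm (posVec_ne_posCov κ e β c' c)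
      · rw [slotMap'_inl_one, slotMap'_inl_one] at hxy; rw [posCov_injective κ e β hxy]
    · exfalso
      rw [slotMap'_inr] at hxy
      rcases Fin.exists_fin_two.mp ⟨t, rfl⟩ with rfl | rfl
      · rw [slotMap'_inl_zero] at hxy; exact not_isSome_posFree κ a' (hxy ▸ isSome_posVec κ e c)
      · rw [slotMap'_inl_one] at hxy; exact not_isSome_posFree κ a' (hxy ▸ isSome_posCov κ e β c)
    · exfalso
      rw [slotMap'_inr] at hxy
      rcases Fin.exists_fin_two.mp ⟨t', rfl⟩ with rfl | rfl
      · rw [slotMap'_inl_zero] at hxy; exact not_isSome_posFree κ a (hxy.symm ▸ isSome_posVec κ e c')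
      · rw [slotMap'_inl_one] at hxy; exact not_isSome_posFree κ a (hxy.symm ▸ isSome_posCov κ e β c')
    · rw [slotMap'_inr, slotMap'_inr] at hxy; rw [posFree_injective κ hxy]
  · intro q
    by_cases hq : (κ q).isSome
    · by_cases hk : patTy κ e (e.symm ⟨q, hq⟩) = true
      · refine ⟨Sum.inl (0, (vecEnum κ e).symm ⟨_, hk⟩), ?_⟩
        rw [slotMap'_inl_zero, posVec, Equiv.apply_symm_apply, Subtype.coe_mk, Equiv.apply_symm_apply]
      · refine ⟨Sum.inl (1, (vecEnum κ e).symm (β.symm ⟨_, by simpa using hk⟩)), ?_⟩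
        rw [slotMap'_inl_one, posCov, Equiv.apply_symm_apply, Equiv.apply_symm_apply, Subtype.coe_mk,
          Equiv.apply_symm_apply]
    · exact ⟨Sum.inr ((freeEnum κ).symm ⟨q, hq⟩), by rw [slotMap'_inr, posFree, Equiv.apply_symm_apply]⟩

/-- **The slot equivalence** of a pattern and a matching: `Fin r ≃ (Fin 2 × pairs) ⊕ free slots`. [folklore] -/
def slotEquiv : Fin r ≃ (Fin 2 × Fin (Fintype.card {k : Fin d // patTy κ e k = true})) ⊕
    Fin (Fintype.card {q : Fin r // ¬ (κ q).isSome}) :=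
  (Equiv.ofBijective _ (slotMap'_bijective κ e β)).symm

/-- `slotEquiv.symm` is the forward slot map. [folklore] -/
theorem slotEquiv_symm_apply (x) : (slotEquiv κ e β).symm x = slotMap' κ e β x := rfl

/-- **The rational placement with exponents `τ` is a matching tensor.** [folklore] -/
theorem sum_ratCoord_smul_eq_matchingTensor (τ : {k : Fin d // patTy κ e k = true} → Fin p) :
    ∑ u : Fin r → Fin (Module.finrank ℚ V), ratCoord Q s κ e β v₀ τ u •
        ((PiTensorProduct.tprod ℚ fun i => (Module.finBasis ℚ V) (u i)) ⊗ₜ[ℚ]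
          (PiTensorProduct.tprod ℚ fun i : Fin 0 => (Fin.elim0 i : Module.Dual ℚ V))) =
      matchingTensor Q s p r _ _ (slotEquiv κ e β) (fun c => τ (vecEnum κ e c)) (fun _ => v₀) := by
  unfold matchingTensor
  refine Finset.sum_congr rfl fun u _ => ?_
  congr 1
  rw [ratCoord, mul_comm]
  congr 1
  · rw [← (vecEnum κ e).prod_comp]
    refine Fintype.prod_congr _ _ fun c => ?_
    rw [slotEquiv_symm_apply, slotEquiv_symm_apply, slotMap'_inl_zero, slotMap'_inl_one]
    rfl
  · rw [← (freeEnum κ).prod_comp]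
    refine Fintype.prod_congr _ _ fun a => ?_
    rw [slotEquiv_symm_apply, slotMap'_inr]
    rfl

include hBs hQn in
/-- **Every pair tensor of the deck-unitary FFT is a complex combination of complexified rational cyclic matching
tensors** (free slots filled with the fixed vector `v₀`). [folklore] -/
theorem pairTensor_mem_span (hβ : ∀ a, patCol κ e (β a) = patCol κ e a) (hsv : s v₀ = v₀) :
    pairTensor (adaptedBasis hσ hζ hp hph hB hBn hn hx₀ hx₀E hgen) κ e β ∈
      Submodule.span ℂ (tensorSpaceToBaseChange ℂ V r 0 ''
        {m : hodgeTensorSpace V r 0 | ∃ (j l : ℕ) (ε : Fin r ≃ (Fin 2 × Fin j) ⊕ Fin l) (τ : Fin j → Fin p)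
          (z : Fin l → V) (_ : ∀ a, s (z a) = z a), m = matchingTensor Q s p r j l ε τ z}) := by
  classical
  rw [← sum_tcoord_smul_tmon (Algebra.TensorProduct.basis ℂ (Module.finBasis ℚ V))
    (pairTensor (adaptedBasis hσ hζ hp hph hB hBn hn hx₀ hx₀E hgen) κ e β)]
  simp_rw [tcoord_pairTensor_eq Q s hσ hζ hp hph hB hBn hBs hQn hn hx₀ hx₀E hgen κ e β hβ, Finset.sum_smul, ← smul_smul]
  rw [Finset.sum_comm]
  refine Submodule.sum_mem _ fun τ _ => ?_
  rw [← Finset.smul_sum]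
  refine Submodule.smul_mem _ _ ?_
  rw [sum_algebraMap_smul_tmon, sum_ratCoord_smul_eq_matchingTensor]
  exact Submodule.subset_span ⟨_, ⟨_, _, slotEquiv κ e β, _, fun _ => v₀, fun _ => hsv, rfl⟩, rfl⟩

end Main

end Summit.HodgeConjecture.HodgeConjecture.Theorems.CyclicUnitaryPowersPairTensorRational

end
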